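import Literature.MathematicalPhysics.QuantumFieldTheory.Balaban1983to89.B6GradLegKLevelV1
import Literature.MathematicalPhysics.QuantumFieldTheory.Balaban1983to89.B6BlockHolderLipschitzV1

/-!
# `Balaban1983to89.B6HolderPairWindowV1` — T. Bałaban, *Propagators and renormalization transformations for lattice gauge theories. II*,
# Commun. Math. Phys. **96** (1984) 223–250 [Balaban1984PropagatorsII], Prop. 2.6 (2.137) p. 247 with p. 238 (the torus `T_□ = □̃³` of a cube):
# THE HÖLDER PAIRS OF A CUBE LIE IN ITS WINDOW — for a cube `□` of the V1 global torus and a pair of fine bonds `x, x′` with `h_□ ≠ 0` at `x`, `x + e_ν`,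
# `x′` or `x′ + e_ν` and `|x − x′|_∞ ≤ L^{j₀(□)+1}` (the admissible pairs of (2.137): `x, x′ ∈ Δ̃(y)`, `|x − x′| ≤ ξ`, blocks of `□⁺` having level
# `≤ j₀ + 1`): the chart translates `x − v_□`, `x′ − v_□` are `1`-deep in the window of `T_□` (so the chart-frame cube lemmas of
# `…B6CubeHolderInDecayV1` / p38's `…B6CubePairOutDecayV1` instantiate), and the member sup-distance of the charted points is at most the
# global one — the GEOMETRIC CORE (a) of the p22/p38 interface for (2.137)₁,₂ at k levels

statement-level skeleton of published theorems with citation tags; proofs where landed; nothing here is a claim about the Yang–Mills mass gap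

PDF held: `paper:balaban1984-cmp96-propagators-rt-ii` (journal page = PDF page + 222): p. 238 [PDF 16], p. 247 [PDF 25].  PRINT p. 238: *"Let us take a
cube □̃³ and identify it with a torus, denoted by T_□, imposing periodicity conditions"*; p. 247 (2.137) with [4] (1.109) p. 35 (the Hölder quotient
over pairs `|x − x′| ≤ ξ`).  OUR READING: `supp h_□` is `4L^{j₀+1}`-deep in the window (r03's `…B6CubeWindowV1.hch_deep`), a displacement of torus
sup-length `≤ D` costs margin `≤ D` and moves every label by `≤ D` WITHOUT WRAP (§1–§2), so both points of an admissible pair near `supp h_□` are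
`1`-deep and their charted labels differ by the same amounts (§3).

CITATION HEADER (lean-in-tree rule) — WHAT IS REPRODUCED.  Phase-2 file of the `lit-balaban` typed skeleton (HOME `run/shared/lean/pub/lit-balaban/`), seat
**p22 gen 26**, free-target (2.137)₁ at k levels (HOME/STATUS TAKING 2026-08-23T22:15Z; p38 g32 interface 23:54Z, item (3)(a)); SKELETON row **B6.Prop2.6**
(cells only; decls of record untouched).  §1 label arithmetic on a torus coordinate (`abs_val_sub_val_le_cdist`: no wrap inside a margin); §2 deep regions
are stable under short displacements (`deepS_of_supDist_le`) and the member chart does not increase sup-distances (`supDist_eS_le`); §3 on the V1 torus: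
`deep_of_hB_ne_zero` / `deep_of_hB_shift_ne_zero` (translates of active bonds are `4L^{j₀+1}(−1)`-deep) and **`pair_window`** (both translates `1`-deep,
member sup-distance `≤` global).  Theorems only; no definition, no `def … : Prop`; standard axioms.
HONEST SCOPE. (1) `≤` (not `=`) for the member distance — equality would need `|x − x′|_∞ ≤ n_T/2`, not used downstream; (2) the placement
`y(x′) ∈ □⁺ ⇒ y(x) ∈ □̃` and the level comparability of the pair are NOT here (p38's side of the interface); (3) V1 torus only; nothing on d = 4 or the
continuum; NOT summit progress.  Unit `lit-balaban-p22` (gen 26), 2026-08-24.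
-/

namespace Literature.MathematicalPhysics.QuantumFieldTheory.Balaban1983to89.B6HolderPairWindowV1

open Finset
open LatticeFieldCalculus
open B3TorusRadialSums (cdist cdist_neg cdist_le_val cdist_le_supDist supDist_eq_sup_cdist eq_or_eq_neg_of_cdist_eq)
open B6MultiLevelBoxOperator (N0 bigSide)
open B6MultiLevelTorusOperator (TDomains)
open B6Cover236MultiLevelBlocks (cubes)
open B6GlobalChartV1 (PV toBox)
open B6AgreeLapV1Chart (eS eB DeepS deepS_mono unshift_mem_deepS mem_cB_W)
open B6Prop25TwoScaleCensus (TSIdx)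
open B6SectAOperatorsV1 (BondIdx)
open B6TranslateV1 (trV trV_apply)
open B6TranslateTorusV1 (vch)
open B6Eq238MultiLevelTorus (svec)
open B6Prop26KLevelSkeletonV1 (hB)
open B6CubeWindowV1 (tC x0 hx0 hfit wC hch hch_deep Placed j0 trV_hB)
open B6BlockHolderLipschitzV1 (supDist_le_of_cdist_le cdist_natCast_le)
open B10StarCount (unshift_shift)

/-! ## §1  Label arithmetic on one torus coordinate -/

section Label

variable {n : ℕ} [NeZero n]

/-- **NO WRAP INSIDE A MARGIN**: if the circular distance `s` of `b − a` is at most the label of `a` and `label(a) + s < n`, then the labels of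
`a` and `b` differ by at most `s` as integers. [cite: Balaban1984PropagatorsII, p.238 (T_□ with periodicity conditions), bookkeeping] -/
theorem abs_val_sub_val_le_cdist {a b : ZMod n} (hlo : cdist (b - a) ≤ a.val) (hhi : a.val + cdist (b - a) < n) :
    |((b.val : ℤ) - a.val)| ≤ cdist (b - a) := by
  set s := cdist (b - a) with hs
  have hsn : s < n := by have := ZMod.val_lt a; omega
  have hsval : ((s : ℕ) : ZMod n).val = s := by rw [ZMod.val_natCast, Nat.mod_eq_of_lt hsn]
  rcases eq_or_eq_neg_of_cdist_eq (b - a) s rfl with h | h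
  · have hb : b = a + (s : ZMod n) := by rw [← h]; ring
    have hv : b.val = a.val + s := by rw [hb, ZMod.val_add_of_lt (by rw [hsval]; exact hhi), hsval]
    rw [hv]; push_cast; rw [add_sub_cancel_left, abs_of_nonneg (by positivity)]
  · have hb : b = a - (s : ZMod n) := by rw [sub_eq_add_neg, ← h]; ring
    have hv : b.val = a.val - s := by rw [hb, ZMod.val_sub (by rw [hsval]; exact hlo), hsval]
    rw [hv, Nat.cast_sub hlo]
    rw [show ((a.val : ℤ) - s) - a.val = -(s : ℤ) by ring, abs_neg, abs_of_nonneg (by positivity)]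

/-- the circular distance of an integer residue is at most its absolute value. [cite: Balaban1984PropagatorsII, p.238 (T_□ with periodicity conditions), bookkeeping (torus distance; ours)] -/
theorem cdist_intCast_le (z : ℤ) : (cdist ((z : ZMod n)) : ℤ) ≤ |z| := by
  rcases le_or_gt 0 z with h | h
  · have h1 : ((z.toNat : ℕ) : ℤ) = z := Int.toNat_of_nonneg h
    have e : ((z.toNat : ℕ) : ZMod n) = (z : ZMod n) := by exact_mod_cast congrArg (fun w : ℤ => (w : ZMod n)) h1
    rw [← e, abs_of_nonneg h]
    calc ((cdist ((z.toNat : ℕ) : ZMod n) : ℕ) : ℤ) ≤ (z.toNat : ℤ) := by exact_mod_cast cdist_natCast_le z.toNat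
      _ = z := h1
  · have h1 : (((-z).toNat : ℕ) : ℤ) = -z := Int.toNat_of_nonneg (by omega)
    have e : (((-z).toNat : ℕ) : ZMod n) = -(z : ZMod n) := by exact_mod_cast congrArg (fun w : ℤ => (w : ZMod n)) h1
    rw [show (z : ZMod n) = -((((-z).toNat : ℕ)) : ZMod n) by rw [e, neg_neg], cdist_neg, abs_of_neg h]
    calc ((cdist (((-z).toNat : ℕ) : ZMod n) : ℕ) : ℤ) ≤ ((-z).toNat : ℤ) := by exact_mod_cast cdist_natCast_le (-z).toNat
      _ = -z := h1

end Label

/-! ## §2  Deep regions under short displacements; the member chart does not increase sup-distances -/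

section Window

variable {d ℓ : ℕ} {hd : 1 ≤ d + 1} {hL : Odd (ℓ + 1) ∧ 1 < ℓ + 1} {a₀ a₁ : ℝ} {m K : ℕ}
variable {t : TSIdx d (ℓ + 1) hd hL a₀ a₁} {x₀ : Fin (d + 1) → ℤ}

/-- **A DISPLACEMENT OF SUP-LENGTH `≤ D` COSTS MARGIN `≤ D` AND MOVES EVERY LABEL BY `≤ D`** (no wrap of the global torus inside the window: corner
`x₀ ≥ 0`, window inside the fundamental period). [cite: Balaban1984PropagatorsII, p.238 (T_□ = □̃³ with periodicity conditions), bookkeeping] -/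
theorem deepS_of_supDist_le (hx₀ : ∀ μ, 0 ≤ x₀ μ) (hfit : ∀ μ, x₀ μ + (t.P.sitesPerDir 0 : ℕ) ≤ ((PV d ℓ m K hd hL).sitesPerDir 0 : ℕ))
    {r D : ℕ} {z z' : Site (PV d ℓ m K hd hL) 0} (hz : z ∈ DeepS t x₀ (r + D)) (hzz' : supDist z z' ≤ D) :
    z' ∈ DeepS t x₀ r ∧ ∀ μ, |(((z' μ).val : ℕ) : ℤ) - ((z μ).val : ℕ)| ≤ D := by
  have hlab : ∀ μ, |(((z' μ).val : ℕ) : ℤ) - ((z μ).val : ℕ)| ≤ D := by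
    intro μ
    obtain ⟨h1, h2⟩ := hz μ
    have hs : cdist (z' μ - z μ) ≤ D := (cdist_le_supDist z' z μ).trans (by rwa [B3TorusRadialSums.supDist_comm] )
    have hlo : cdist (z' μ - z μ) ≤ (z μ).val := by have := hx₀ μ; omega
    have hhi : (z μ).val + cdist (z' μ - z μ) < (PV d ℓ m K hd hL).sitesPerDir 0 := by have := hfit μ; omega
    exact (abs_val_sub_val_le_cdist hlo hhi).trans (by exact_mod_cast hs)
  refine ⟨fun μ => ?_, hlab⟩
  obtain ⟨h1, h2⟩ := hz μ
  have h := hlab μ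
  rw [abs_le] at h
  constructor <;> omega

/-- **THE MEMBER CHART DOES NOT INCREASE SUP-DISTANCES**: for window sites whose labels differ by at most `D` coordinatewise, the charted sites of
`T_□` are within member sup-distance `D`. [cite: Balaban1984PropagatorsII, p.238 (T_□), bookkeeping] -/
theorem supDist_eS_le {D : ℕ} {z z' : Site (PV d ℓ m K hd hL) 0} (h : ∀ μ, |(((z' μ).val : ℕ) : ℤ) - ((z μ).val : ℕ)| ≤ D) :
    supDist (eS t x₀ z) (eS t x₀ z') ≤ D := by
  refine supDist_le_of_cdist_le _ _ fun μ => ?_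
  have e : eS t x₀ z μ - eS t x₀ z' μ = (((((z μ).val : ℕ) : ℤ) - ((z' μ).val : ℕ) : ℤ) : ZMod (t.P.sitesPerDir 0)) := by
    simp only [eS]; push_cast; ring
  rw [e]
  have h1 := cdist_intCast_le (n := t.P.sitesPerDir 0) ((((z μ).val : ℕ) : ℤ) - ((z' μ).val : ℕ))
  have h2 : |((((z μ).val : ℕ) : ℤ) - ((z' μ).val : ℕ))| ≤ D := by rw [abs_sub_comm]; exact h μ
  exact_mod_cast h1.trans h2

/-- translation does not change sup-distances. [cite: Balaban1984PropagatorsII, (2.1) p.224, p.238 (translations of the torus), bookkeeping] -/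
theorem supDist_translate (a : Site (PV d ℓ m K hd hL) 0) (x x' : PBond (PV d ℓ m K hd hL) 0) :
    supDist (x.translate a).src (x'.translate a).src = supDist x.src x'.src := by
  rw [supDist_eq_sup_cdist, supDist_eq_sup_cdist]
  congr 1
  funext μ
  rw [PBond.translate_src, PBond.translate_src, Site.add_apply, Site.add_apply, add_sub_add_right_eq_sub]

end Window

/-! ## §3  On the V1 torus: the Hölder pairs of a cube lie in its window -/

section Cube

variable {d ℓ : ℕ} {hd : 1 ≤ d + 1} {hL : Odd (ℓ + 1) ∧ 1 < ℓ + 1} {a₀ a₁ : ℝ} {m K : ℕ} {Mh k R : ℕ} {P' : Fin (d + 1) → ℕ}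
variable (hN : ∀ μ, N0 ℓ Mh k P' μ = (PV d ℓ m K hd hL).sitesPerDir 0) {D : TDomains d ℓ Mh k P' R} (hk : k ≤ m + K)
  (hMh1 : 1 ≤ Mh) (hP4 : ∀ μ, 4 ≤ P' μ) {a : ℕ} (hMha : Mh = (ℓ + 1) ^ a) (c : ↥(cubes D.toDomains)) (ha : a₀ ≤ a₁)

/-- `x − 0 = x` for bonds. [folklore] -/
private theorem translate_zero' (x : PBond (PV d ℓ m K hd hL) 0) : x.translate 0 = x := by
  cases x; simp [PBond.translate]

include hMha in
/-- **THE TRANSLATE OF AN ACTIVE BOND IS `4L^{j₀+1}`-DEEP**: `h_□(x) ≠ 0 ⟹ x − v_□ ∈ DeepS(4L^{j₀+1})` (r03's `hch_deep` read through `τ_v h_□ = h^ch_□`).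
[cite: Balaban1984PropagatorsII, p.229 («cubes □ of the size 2ML^jη»), p.238 (□ ⊂ □̃³)] -/
theorem deep_of_hB_ne_zero (hM8 : 8 ≤ Mh) (hR2 : 2 * (ℓ + 1) ^ 2 ≤ R) (w : BondIdx (B6GlobalChartV1.domT hN D hk) → ℝ) (cf : ℝ)
    {x : PBond (PV d ℓ m K hd hL) 0} (hx : hB hN D c x ≠ 0) :
    (x.translate (-vch Mh k (svec ℓ k c.1.1 c.1.2))).src ∈
      DeepS (tC hN hk hMh1 hP4 c ha a (wC hN hk c w) cf) (x0 ℓ Mh k c.1) (4 * (ℓ + 1) ^ (j0 hMh1 hP4 c + 1)) := by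
  have h : hch hN hMh1 hP4 c (x.translate (-vch Mh k (svec ℓ k c.1.1 c.1.2))) ≠ 0 := by
    rwa [← trV_hB hN hMh1 hP4 c, trV_apply, PBond.translate_translate, neg_add_cancel, translate_zero']
  exact hch_deep hN hMh1 hP4 hMha c ha hM8 hR2 h

include hMha in
/-- the same one step back: `h_□(x + e_ν) ≠ 0 ⟹ x − v_□ ∈ DeepS(4L^{j₀+1} − 1)`. [cite: Balaban1984PropagatorsII, p.238 (□ ⊂ □̃³), bookkeeping] -/
theorem deep_of_hB_shift_ne_zero (hM8 : 8 ≤ Mh) (hR2 : 2 * (ℓ + 1) ^ 2 ≤ R) (hpl : Placed ℓ k P' c.1) (w : BondIdx (B6GlobalChartV1.domT hN D hk) → ℝ)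
    (cf : ℝ) (ν : Fin (d + 1)) {x : PBond (PV d ℓ m K hd hL) 0} (hx : hB hN D c ⟨x.src.shift ν, x.dir⟩ ≠ 0) :
    (x.translate (-vch Mh k (svec ℓ k c.1.1 c.1.2))).src ∈
      DeepS (tC hN hk hMh1 hP4 c ha a (wC hN hk c w) cf) (x0 ℓ Mh k c.1) (4 * (ℓ + 1) ^ (j0 hMh1 hP4 c + 1) - 1) := by
  have h1 := deep_of_hB_ne_zero hN hk hMh1 hP4 hMha c ha hM8 hR2 w cf hx
  have e : (PBond.translate (-vch Mh k (svec ℓ k c.1.1 c.1.2)) ⟨x.src.shift ν, x.dir⟩).src =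
      ((x.translate (-vch Mh k (svec ℓ k c.1.1 c.1.2))).src).shift ν := by
    funext κ
    rw [PBond.translate_src, PBond.translate_src, Site.add_apply]
    by_cases hκ : κ = ν
    · subst hκ; simp only [Site.shift, Function.update_self, Site.add_apply]; ring
    · simp only [Site.shift, Function.update_of_ne hκ, Site.add_apply]
  rw [e] at h1
  have h4 : 1 ≤ 4 * (ℓ + 1) ^ (j0 hMh1 hP4 c + 1) := le_trans (Nat.one_le_pow _ _ (Nat.succ_pos ℓ)) (Nat.le_mul_of_pos_left _ (by norm_num))
  have h1' : ((x.translate (-vch Mh k (svec ℓ k c.1.1 c.1.2))).src).shift ν ∈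
      DeepS (tC hN hk hMh1 hP4 c ha a (wC hN hk c w) cf) (x0 ℓ Mh k c.1) ((4 * (ℓ + 1) ^ (j0 hMh1 hP4 c + 1) - 1) + 1) := by
    rwa [Nat.sub_add_cancel h4]
  have h2 := (unshift_mem_deepS (t := tC hN hk hMh1 hP4 c ha a (wC hN hk c w) cf) (hx0 hpl) h1' ν).1
  rwa [unshift_shift] at h2

include hMha in
/-- **THE HÖLDER PAIRS OF A CUBE LIE IN ITS WINDOW** (`M_h ≥ 8`, `R ≥ 2L²`, `L ≥ 2`): if `h_□ ≠ 0` at `x`, `x + e_ν`, `x′` or `x′ + e_ν` and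
`|x − x′|_∞ ≤ L^{j₀+1}`, then `x − v_□` and `x′ − v_□` are `1`-deep in the window of `T_□` and the member sup-distance of their charts is at most
`|x − x′|_∞`. [cite: Balaban1984PropagatorsII, Prop. 2.6 (2.137) p.247 (pairs x, x′ ∈ Δ̃(y), |x − x′| ≤ ξ), p.238 (T_□ = □̃³); Balaban1984PropagatorsI, (1.109) p.35] -/
theorem pair_window (hM8 : 8 ≤ Mh) (hR2 : 2 * (ℓ + 1) ^ 2 ≤ R) (hpl : Placed ℓ k P' c.1) (w : BondIdx (B6GlobalChartV1.domT hN D hk) → ℝ) (cf : ℝ)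
    (ν : Fin (d + 1)) {x x' : PBond (PV d ℓ m K hd hL) 0}
    (hact : hB hN D c x ≠ 0 ∨ hB hN D c ⟨x.src.shift ν, x.dir⟩ ≠ 0 ∨ hB hN D c x' ≠ 0 ∨ hB hN D c ⟨x'.src.shift ν, x'.dir⟩ ≠ 0)
    (hdist : supDist x.src x'.src ≤ (ℓ + 1) ^ (j0 hMh1 hP4 c + 1)) :
    (x.translate (-vch Mh k (svec ℓ k c.1.1 c.1.2))).src ∈ DeepS (tC hN hk hMh1 hP4 c ha a (wC hN hk c w) cf) (x0 ℓ Mh k c.1) 1 ∧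
    (x'.translate (-vch Mh k (svec ℓ k c.1.1 c.1.2))).src ∈ DeepS (tC hN hk hMh1 hP4 c ha a (wC hN hk c w) cf) (x0 ℓ Mh k c.1) 1 ∧
    supDist (eB (tC hN hk hMh1 hP4 c ha a (wC hN hk c w) cf) (x0 ℓ Mh k c.1) (x.translate (-vch Mh k (svec ℓ k c.1.1 c.1.2)))).src
        (eB (tC hN hk hMh1 hP4 c ha a (wC hN hk c w) cf) (x0 ℓ Mh k c.1) (x'.translate (-vch Mh k (svec ℓ k c.1.1 c.1.2)))).src ≤
      supDist x.src x'.src := by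
  have hfit' := hfit hN hMh1 hP4 hMha c ha hpl
  have hx0' := hx0 (ℓ := ℓ) (Mh := Mh) (k := k) hpl
  have hD1 : 1 ≤ (ℓ + 1) ^ (j0 hMh1 hP4 c + 1) := Nat.one_le_pow _ _ (Nat.succ_pos ℓ)
  have hdist' : supDist (x.translate (-vch Mh k (svec ℓ k c.1.1 c.1.2))).src (x'.translate (-vch Mh k (svec ℓ k c.1.1 c.1.2))).src ≤
      (ℓ + 1) ^ (j0 hMh1 hP4 c + 1) := by rw [supDist_translate]; exact hdist
  have hdist'' : supDist (x'.translate (-vch Mh k (svec ℓ k c.1.1 c.1.2))).src (x.translate (-vch Mh k (svec ℓ k c.1.1 c.1.2))).src ≤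
      (ℓ + 1) ^ (j0 hMh1 hP4 c + 1) := by rw [B3TorusRadialSums.supDist_comm]; exact hdist'
  -- from a `(4D − 1)`-deep point to the pair: margins `4D − 1 ≥ (1 + D)`, labels move by `≤ D`
  have key : ∀ {z z' : Site (PV d ℓ m K hd hL) 0},
      z ∈ DeepS (tC hN hk hMh1 hP4 c ha a (wC hN hk c w) cf) (x0 ℓ Mh k c.1) (4 * (ℓ + 1) ^ (j0 hMh1 hP4 c + 1) - 1) →
      supDist z z' ≤ (ℓ + 1) ^ (j0 hMh1 hP4 c + 1) →
      z ∈ DeepS (tC hN hk hMh1 hP4 c ha a (wC hN hk c w) cf) (x0 ℓ Mh k c.1) 1 ∧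
        z' ∈ DeepS (tC hN hk hMh1 hP4 c ha a (wC hN hk c w) cf) (x0 ℓ Mh k c.1) 1 ∧
        supDist (eS (tC hN hk hMh1 hP4 c ha a (wC hN hk c w) cf) (x0 ℓ Mh k c.1) z)
            (eS (tC hN hk hMh1 hP4 c ha a (wC hN hk c w) cf) (x0 ℓ Mh k c.1) z') ≤ supDist z z' := by
    intro z z' hz hzz'
    have hz2 : z ∈ DeepS (tC hN hk hMh1 hP4 c ha a (wC hN hk c w) cf) (x0 ℓ Mh k c.1) (1 + supDist z z') := deepS_mono (by omega) hz
    obtain ⟨hz', hlab⟩ := deepS_of_supDist_le hx0' hfit' hz2 le_rfl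
    exact ⟨deepS_mono (by omega) hz, hz', supDist_eS_le hlab⟩
  have hsymm : ∀ {z z' : Site (PV d ℓ m K hd hL) 0},
      supDist (eS (tC hN hk hMh1 hP4 c ha a (wC hN hk c w) cf) (x0 ℓ Mh k c.1) z') (eS (tC hN hk hMh1 hP4 c ha a (wC hN hk c w) cf) (x0 ℓ Mh k c.1) z) ≤
        supDist z' z →
      supDist (eS (tC hN hk hMh1 hP4 c ha a (wC hN hk c w) cf) (x0 ℓ Mh k c.1) z) (eS (tC hN hk hMh1 hP4 c ha a (wC hN hk c w) cf) (x0 ℓ Mh k c.1) z') ≤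
        supDist z z' := by
    intro z z' h; rwa [B3TorusRadialSums.supDist_comm, B3TorusRadialSums.supDist_comm z'] at h
  have hmono : 4 * (ℓ + 1) ^ (j0 hMh1 hP4 c + 1) - 1 ≤ 4 * (ℓ + 1) ^ (j0 hMh1 hP4 c + 1) := Nat.sub_le _ _
  simp only [eB]
  rcases hact with h | h | h | h
  · obtain ⟨h1, h2, h3⟩ := key (deepS_mono hmono (deep_of_hB_ne_zero hN hk hMh1 hP4 hMha c ha hM8 hR2 w cf h)) hdist'
    exact ⟨h1, h2, h3.trans (le_of_eq (supDist_translate _ _ _))⟩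
  · obtain ⟨h1, h2, h3⟩ := key (deep_of_hB_shift_ne_zero hN hk hMh1 hP4 hMha c ha hM8 hR2 hpl w cf ν h) hdist'
    exact ⟨h1, h2, h3.trans (le_of_eq (supDist_translate _ _ _))⟩
  · obtain ⟨h1, h2, h3⟩ := key (deepS_mono hmono (deep_of_hB_ne_zero hN hk hMh1 hP4 hMha c ha hM8 hR2 w cf h)) hdist''
    exact ⟨h2, h1, (hsymm h3).trans (le_of_eq (supDist_translate _ _ _))⟩
  · obtain ⟨h1, h2, h3⟩ := key (deep_of_hB_shift_ne_zero hN hk hMh1 hP4 hMha c ha hM8 hR2 hpl w cf ν h) hdist''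
    exact ⟨h2, h1, (hsymm h3).trans (le_of_eq (supDist_translate _ _ _))⟩

/-- `1`-deep sites are window bonds, and so are their forward neighbours. [cite: Balaban1984PropagatorsII, p.238 (□ ⊂ □̃³), bookkeeping] -/
theorem mem_W_of_deep_one {hpl : Placed ℓ k P' c.1} {w : BondIdx (B6GlobalChartV1.domT hN D hk) → ℝ} {cf : ℝ} {b : PBond (PV d ℓ m K hd hL) 0}
    (hb : b.src ∈ DeepS (tC hN hk hMh1 hP4 c ha a (wC hN hk c w) cf) (x0 ℓ Mh k c.1) 1) (ν : Fin (d + 1)) :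
    b ∈ (B6AgreeLapV1Chart.cB (tC hN hk hMh1 hP4 c ha a (wC hN hk c w) cf) (x0 ℓ Mh k c.1) (hx0 hpl) (hfit hN hMh1 hP4 hMha c ha hpl)).W ∧
    (⟨b.src.shift ν, b.dir⟩ : PBond (PV d ℓ m K hd hL) 0) ∈
      (B6AgreeLapV1Chart.cB (tC hN hk hMh1 hP4 c ha a (wC hN hk c w) cf) (x0 ℓ Mh k c.1) (hx0 hpl) (hfit hN hMh1 hP4 hMha c ha hpl)).W := by
  refine ⟨mem_cB_W.2 (deepS_mono (Nat.zero_le 1) hb), mem_cB_W.2 ?_⟩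
  exact (B6AgreeLapV1Chart.shift_mem_deepS (hfit hN hMh1 hP4 hMha c ha hpl) (r := 0) hb ν).1

end Cube

end Literature.MathematicalPhysics.QuantumFieldTheory.Balaban1983to89.B6HolderPairWindowV1
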